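/-
Copyright (c) 2026 the pub-hodgecm-mathlib formalisation cell (harness21).  Prover seat hodgecm-mathlib-K2E3-p26 (g3), Track B «K2-LIT», hLiu418 = `stmt-HodgeConjecture-24832`;
socket #41 KIND 1, block K1-a♮ — K1a desk K2Liu-p01 (g11) WORD #12 ∕ LEAD F0P6-plan (g15) BATCH #262: THE LOC-FACE GROWTH LETTER `hGnv` (the per-place size letter of LH7-p05 (g3)'s
(L3-den) finite head `hGnb_of_placeBounds`, 📤 p864641), HYPOTHESIS-FIRST over the VALUE data of the local face (★ p863695's ball clause shape) with the three per-place
analytic letters NAMED.  THEOREMS ONLY (no `def`, no `instance`, no notation, no named-fact hypothesis, no `sorry`); lane `--supports stmt-HodgeConjecture-24832 --as helper`.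
-/
import Summits.HodgeConjecture.HodgeConjecture.Theorems.K2LiuKindOneSingularLocalFaceBall      -- ★ p863695 (F0P2-p11): the ball ∕ value edition of the local face (`cW N₂ k₀`, `primePowBall`)
import Summits.HodgeConjecture.HodgeConjecture.Theorems.K2LiuKindOneSingularLocalFaceOfRecord  -- ★ p864353 (K2Liu-p01): the LOC-FACE producer's frame (`HA`, `GLn.localHeight`, `skewMatrices`)
import Literature.NumberTheory.Automorphic.AdelicHeightGLProofs                                -- ★ `GLn.one_le_localHeight`
import Literature.NumberTheory.Automorphic.TateLocalZetaShells                                 -- ★ `measure_primePowBall_lt_top`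
import HarnessLib

/-!
# Crux `HLiu418`, socket #41 KIND 1 a♮ — `K2LiuKindOneSingularLocalFaceGrowth`: THE PER-PLACE GROWTH OF THE LOCAL FACE `Gn S i v s h` NEAR `z`, FROM ITS BALL ∕ VALUE DATA

Cell `hodgecm-mathlib`, crux item hLiu418 = `stmt-HodgeConjecture-24832` (helper lane, count-neutral), route of record `HCCMUnconditional`; squad K2 ∕ K2Liu, road `K2_Liu`,
socket #41 `sig_K2LiuSiegelEisensteinContinuation`, KIND 1, block K1-a♮; author K2E3-p26 (g3); K1a desk K2Liu-p01 (g11); consumer LH7-p05 (g3) (📤 p864641 `hGnb_of_placeBounds`,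
whose binder `hGnv` :126–:131 is this file's conclusion VERBATIM).
THE MATHEMATICS [KudlaRallis1994, §2], [KudlaSweet1997, §1], [HarrisKudlaSweet1996, §6 (6.14)–(6.16)], [CasselmanShalika1980, §2], [BorelJacquet1979, §1.2].
The local face of the kind-one singular term is, by ★ p863695's ball clause, `Gn S i v s h = cW(s) · ∫_{x ∈ 𝔭_v^{−k₀}} ψ̄_v(x)·N₂(s, x, h) dμ_v` for `0 < re s` (a character value
of modulus `≤ 1` against the normalised short-root section `N₂` on a ball of radius `q_v^{k₀}`).  Hence `‖Gn‖ ≤ ‖cW(s)‖ · μ_v(𝔭_v^{−k₀}) · sup_{x} ‖N₂‖`, and three per-place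
VALUE letters turn this into LH7-p05's polynomial shape: (a) `‖cW(s)‖ ≤ q_v^{a}` near `z` (the `L`-factor ∕ `χ_s(m₀)` values), (b) `q_v^{k₀} ≤ (q_v^{mτ}·∏_{w∣v} H_w((g_c(S)h)_w))^{c}`
(ball radius = conductor exponent `mτ = ord_v τ` + the level of the translate, controlled by its local heights), (c) `‖N₂(s,x,h)‖ ≤ (q_v^{k₀}·∏_w H_w)^{c′}` on the ball near `z`
(flat section value × `|χ_s(p(·))|`), plus (d) the Haar normalisation `μ_v(𝔭_v^{−k}) ≤ q_v^{k}`.  All constants are absorbed by `2 ≤ q_v` and `1 ≤ H_w`; the exponent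
`Mv := a + c(c′+1) + c′` is uniform in `(S, i, v, h)`.
* §1 generic bookkeeping (a ball integral against a bounded integrand; absorption of monomials);
* §2 HEAD **`hGnv_of_localFace`** ⊢ LH7-p05 (g3)'s `hGnv` bytes (📤 p864641 :126–:131) VERBATIM, hypothesis-first over `(Gn cW k₀ N₂v ψv μF)` + `hball` + the NAMED letters
  `hcW hk₀ hN₂ hvol hψ` (each a per-place VALUE export owed by the LOC-FACE proof region: ★ p863695 ED. ∕ FILE B of the (R2′) road).

HONEST LABEL.  Count-neutral helper, hypothesis-first: it names the per-place value letters, it pays none of them; `HC_CM` is proved only modulo the 7 printed citations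
(2 remaining named inputs: hLiu418 = `stmt-HodgeConjecture-24832`, h413 = `stmt-HodgeConjecture-24833`) until rung 0 closes.

## References
* [KudlaRallis1994] S. Kudla, S. Rallis, *A regularized Siegel–Weil formula: the first term identity*, Ann. of Math. 140 (1994), §2 (local faces of the singular terms).
* [KudlaSweet1997] S. Kudla, W. J. Sweet, *Degenerate principal series representations for U(n,n)*, Israel J. Math. 98 (1997), §1 (`q^{−s}`-rational local coefficients).
* [HarrisKudlaSweet1996] M. Harris, S. Kudla, W. J. Sweet, J. AMS 9 (1996), §6 (6.14)–(6.16) (ball decomposition of the local Whittaker-type integrals).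
* [CasselmanShalika1980] W. Casselman, J. Shalika, Compositio Math. 41 (1980), §2 (values of normalised sections).
* [BorelJacquet1979] A. Borel, H. Jacquet, Proc. Sympos. Pure Math. 33.1 (1979), §1.2 (local heights).
-/

set_option autoImplicit false
-- the mandated namespace repeats the single-problem summit's segment (`HodgeConjecture.HodgeConjecture`)
set_option linter.dupNamespace false

noncomputable section

open scoped NNReal ENNReal ComplexConjugate BigOperators
open NumberField IsDedekindDomain MeasureTheory
open Literature.NumberTheory.Automorphic Literature.NumberTheory.Automorphic.UnitaryGroup Literature.NumberTheory.GaloisRepresentations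
open Literature.NumberTheory.GelbartRogawski1991 Literature.NumberTheory.GelbartRogawski1991.GRConstruction
open Literature.NumberTheory.GelbartRogawski1991.UnitaryDualPair
open Literature.NumberTheory.K2Lit.SiegelDoubled
open Summit.HodgeConjecture.HodgeConjecture.Cruxes.HLiu418.K2LiuSiegelUnipotentFourierDefs

namespace Summit.HodgeConjecture.HodgeConjecture.Cruxes.HLiu418.K2LiuKindOneSingularLocalFaceGrowth

/-! ## §1 Generic bookkeeping -/

section Generic

/-- **a ball integral against a bounded integrand**: `‖c · ∫_B ψ·N‖ ≤ A · (V · B₀)` when `‖c‖ ≤ A`, `‖ψ‖ ≤ 1`, `‖N‖ ≤ B₀` on `B` and `μ(B) ≤ V < ∞`. [folklore] -/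
theorem norm_mul_setIntegral_le {X : Type*} [MeasurableSpace X] (μ : Measure X) {B : Set X} (hB : μ B < ∞) {c : ℂ} {ψ N : X → ℂ} {A V B₀ : ℝ}
    (hc : ‖c‖ ≤ A) (hψ : ∀ x, ‖ψ x‖ ≤ 1) (hN : ∀ x ∈ B, ‖N x‖ ≤ B₀) (hB₀ : 0 ≤ B₀) (hV : μ.real B ≤ V) :
    ‖c * ∫ x in B, ψ x * N x ∂μ‖ ≤ A * (V * B₀) := by
  have hA : 0 ≤ A := (norm_nonneg _).trans hc
  rw [norm_mul]
  refine mul_le_mul hc ?_ (norm_nonneg _) hA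
  have h1 : ‖∫ x in B, ψ x * N x ∂μ‖ ≤ B₀ * μ.real B :=
    norm_setIntegral_le_of_norm_le_const hB fun x hx => by
      rw [norm_mul]
      exact (mul_le_mul (hψ x) (hN x hx) (norm_nonneg _) zero_le_one).trans (by rw [one_mul])
  calc ‖∫ x in B, ψ x * N x ∂μ‖ ≤ B₀ * μ.real B := h1
    _ ≤ B₀ * V := mul_le_mul_of_nonneg_left hV hB₀
    _ = V * B₀ := mul_comm _ _

/-- **absorption of monomials**: for `2 ≤ q`, `1 ≤ P`, `1 ≤ K`, `K ≤ (q^m·P)^c`: `q^a · (K · (K·P)^{c′}) ≤ (q^{m+1}·P)^{a + c(c′+1) + c′}`. [folklore] -/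
theorem monomial_absorb {q P K : ℝ} (hq : 2 ≤ q) (hP : 1 ≤ P) (hK : 1 ≤ K) {m a c c' : ℕ} (hKc : K ≤ (q ^ m * P) ^ c) :
    q ^ a * (K * (K * P) ^ c') ≤ (q ^ (m + 1) * P) ^ (a + c * (c' + 1) + c') := by
  have hq1 : 1 ≤ q := le_trans one_le_two hq
  have hB1 : 1 ≤ q ^ m * P := one_le_mul_of_one_le_of_one_le (one_le_pow₀ hq1) hP
  have hB1' : 1 ≤ q ^ (m + 1) * P := one_le_mul_of_one_le_of_one_le (one_le_pow₀ hq1) hP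
  have hPB : P ≤ q ^ m * P := le_mul_of_one_le_left (zero_le_one.trans hP) (one_le_pow₀ hq1)
  have hBB' : q ^ m * P ≤ q ^ (m + 1) * P := mul_le_mul_of_nonneg_right (pow_le_pow_right₀ hq1 (Nat.le_succ m)) (zero_le_one.trans hP)
  have hB0 : 0 ≤ q ^ m * P := zero_le_one.trans hB1
  -- `q^a ≤ (q^{m+1} P)^a`
  have h1 : q ^ a ≤ (q ^ (m + 1) * P) ^ a := by
    refine pow_le_pow_left₀ (zero_le_one.trans hq1) ?_ a
    calc q = q ^ (0 + 1) * 1 := by rw [zero_add, pow_one, mul_one]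
      _ ≤ q ^ (m + 1) * P := mul_le_mul (pow_le_pow_right₀ hq1 (Nat.succ_le_succ (Nat.zero_le m))) hP zero_le_one (pow_nonneg (zero_le_one.trans hq1) _)
  -- `K · (K P)^{c'} ≤ B^{c} · (B^{c} · B)^{c'} = B^{c(c'+1) + c'}`
  have h2 : K * (K * P) ^ c' ≤ (q ^ m * P) ^ (c * (c' + 1) + c') := by
    calc K * (K * P) ^ c' ≤ (q ^ m * P) ^ c * ((q ^ m * P) ^ c * (q ^ m * P)) ^ c' :=
          mul_le_mul hKc (pow_le_pow_left₀ (mul_nonneg (zero_le_one.trans hK) (zero_le_one.trans hP)) (mul_le_mul hKc hPB (zero_le_one.trans hP) (pow_nonneg hB0 _)) c')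
            (pow_nonneg (mul_nonneg (zero_le_one.trans hK) (zero_le_one.trans hP)) _) (pow_nonneg hB0 _)
      _ = (q ^ m * P) ^ (c * (c' + 1) + c') := by rw [← pow_succ, ← pow_mul, ← pow_add]; ring_nf
  calc q ^ a * (K * (K * P) ^ c') ≤ (q ^ (m + 1) * P) ^ a * (q ^ m * P) ^ (c * (c' + 1) + c') :=
        mul_le_mul h1 h2 (mul_nonneg (zero_le_one.trans hK) (pow_nonneg (mul_nonneg (zero_le_one.trans hK) (zero_le_one.trans hP)) _)) (pow_nonneg (zero_le_one.trans hB1') _)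
    _ ≤ (q ^ (m + 1) * P) ^ a * (q ^ (m + 1) * P) ^ (c * (c' + 1) + c') :=
        mul_le_mul_of_nonneg_left (pow_le_pow_left₀ hB0 hBB' _) (pow_nonneg (zero_le_one.trans hB1') _)
    _ = (q ^ (m + 1) * P) ^ (a + c * (c' + 1) + c') := by rw [← pow_add, add_assoc]

end Generic

/-! ## §2 HEAD: the growth letter `hGnv` from the ball ∕ value data of the local face -/

section Head

variable (L : Type) [Field L] [NumberField L] [IsCMField L] {N M : ℕ} (e : Fin N × Fin M ≃ Fin 2)
  (dV : Fin N → L) (hdV : ∀ i, IsCMField.complexConj L (dV i) = dV i)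
  (dW : Fin M → L) (hdW : ∀ i, IsCMField.complexConj L (dW i) = dW i)

/-- **HEAD `hGnv_of_localFace` — THE LOC-FACE GROWTH LETTER, HYPOTHESIS-FIRST.**  INPUT, BY VALUE: the corner translate `gc`, the local index sets `T`, the conductor exponents `mτ`,
the tensor index sets `I`, the local face `Gn` (★ p864353 ∕ FILE C's `choose`) together with its BALL ∕ VALUE DATA in ★ p863695's shape — the scalar `cW`, the ball exponent `k₀`,
the integrand `N₂v` (the normalised short-root section read along the ball), a character weight `ψv` of modulus `≤ 1`, the additive Haar measures `μF` — and the ball clause `hball`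
(`Gn = cW · ∫_{𝔭_v^{−k₀}} ψv·N₂v` on `0 < re s`); NAMED per-place VALUE letters: `hcW` (a), `hk₀` (b), `hN₂` (c), `hvol` (d).  OUTPUT: LH7-p05 (g3)'s `hGnv` (📤 p864641 :126–:131)
VERBATIM — `‖Gn S i v s h‖ ≤ (q_v^{mτ S v + 1} · ∏_{w∣v} H_w((gc S·h)_w))^{Mv}` on a disc at `z`, `Mv := a + c(c′+1) + c′` uniform.
[cite: KudlaRallis1994, §2] [cite: KudlaSweet1997, §1] [cite: HarrisKudlaSweet1996, §6 (6.14)–(6.16)] [cite: CasselmanShalika1980, §2] [cite: BorelJacquet1979, §1.2] -/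
theorem hGnv_of_localFace [∀ v : HeightOneSpectrum (𝓞 (Fp L)), MeasurableSpace (v.adicCompletion (Fp L))]
    (gc : skewMatrices ((IsCMField.complexConj L : L ≃ₐ[Fp L] L) : L →+* L) ((gramR L e dV hdV dW hdW).map (algebraMap (Fp L) L)) → HA L e dV hdV dW hdW)
    (T : skewMatrices ((IsCMField.complexConj L : L ≃ₐ[Fp L] L) : L →+* L) ((gramR L e dV hdV dW hdW).map (algebraMap (Fp L) L)) → HA L e dV hdV dW hdW →
      Finset (HeightOneSpectrum (𝓞 (Fp L))))
    (mτ : skewMatrices ((IsCMField.complexConj L : L ≃ₐ[Fp L] L) : L →+* L) ((gramR L e dV hdV dW hdW).map (algebraMap (Fp L) L)) → HeightOneSpectrum (𝓞 (Fp L)) → ℕ)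
    {ι' : Type*} (I : skewMatrices ((IsCMField.complexConj L : L ≃ₐ[Fp L] L) : L →+* L) ((gramR L e dV hdV dW hdW).map (algebraMap (Fp L) L)) → HA L e dV hdV dW hdW → Finset ι')
    (Gn : skewMatrices ((IsCMField.complexConj L : L ≃ₐ[Fp L] L) : L →+* L) ((gramR L e dV hdV dW hdW).map (algebraMap (Fp L) L)) → ι' →
      HeightOneSpectrum (𝓞 (Fp L)) → ℂ → HA L e dV hdV dW hdW → ℂ)
    -- the ball ∕ value data of the local face (★ p863695's shape), BY VALUE
    (cW : skewMatrices ((IsCMField.complexConj L : L ≃ₐ[Fp L] L) : L →+* L) ((gramR L e dV hdV dW hdW).map (algebraMap (Fp L) L)) → ι' → HeightOneSpectrum (𝓞 (Fp L)) → ℂ → ℂ)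
    (k₀ : skewMatrices ((IsCMField.complexConj L : L ≃ₐ[Fp L] L) : L →+* L) ((gramR L e dV hdV dW hdW).map (algebraMap (Fp L) L)) → ι' → HeightOneSpectrum (𝓞 (Fp L)) →
      HA L e dV hdV dW hdW → ℕ)
    (N₂v : skewMatrices ((IsCMField.complexConj L : L ≃ₐ[Fp L] L) : L →+* L) ((gramR L e dV hdV dW hdW).map (algebraMap (Fp L) L)) → ι' → (v : HeightOneSpectrum (𝓞 (Fp L))) → ℂ →
      HA L e dV hdV dW hdW → v.adicCompletion (Fp L) → ℂ)
    (ψv : skewMatrices ((IsCMField.complexConj L : L ≃ₐ[Fp L] L) : L →+* L) ((gramR L e dV hdV dW hdW).map (algebraMap (Fp L) L)) → (v : HeightOneSpectrum (𝓞 (Fp L))) →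
      v.adicCompletion (Fp L) → ℂ)
    (hψ : ∀ S (v : HeightOneSpectrum (𝓞 (Fp L))) (x : v.adicCompletion (Fp L)), ‖ψv S v x‖ ≤ 1)
    (μF : ∀ v : HeightOneSpectrum (𝓞 (Fp L)), Measure (v.adicCompletion (Fp L))) [∀ v, IsFiniteMeasureOnCompacts (μF v)]
    (hball : ∀ S : skewMatrices ((IsCMField.complexConj L : L ≃ₐ[Fp L] L) : L →+* L) ((gramR L e dV hdV dW hdW).map (algebraMap (Fp L) L)),
      (S : Matrix (Fin 2) (Fin 2) L) ≠ 0 → (S : Matrix (Fin 2) (Fin 2) L).det = 0 → ∀ (h : HA L e dV hdV dW hdW), ∀ i ∈ I S h, ∀ v ∈ T S h, ∀ s : ℂ, 0 < s.re →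
        Gn S i v s h = cW S i v s * ∫ x in primePowBall (v.adicCompletion (Fp L)) (-(k₀ S i v h : ℤ)), ψv S v x * N₂v S i v s h x ∂(μF v))
    -- (a) the scalar near `z`
    (hcW : ∀ z : ℂ, 0 < z.re → ∃ (a : ℕ) (r : ℝ), 0 < r ∧
      ∀ (S : skewMatrices ((IsCMField.complexConj L : L ≃ₐ[Fp L] L) : L →+* L) ((gramR L e dV hdV dW hdW).map (algebraMap (Fp L) L))) (s : ℂ), dist s z < r →
      ∀ (h : HA L e dV hdV dW hdW), ∀ i ∈ I S h, ∀ v ∈ T S h, ‖cW S i v s‖ ≤ ((v.residueCard : ℕ) : ℝ) ^ a)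
    -- (b) the ball exponent against the conductor exponent and the local heights of the translate
    (hk₀ : ∃ c : ℕ, ∀ (S : skewMatrices ((IsCMField.complexConj L : L ≃ₐ[Fp L] L) : L →+* L) ((gramR L e dV hdV dW hdW).map (algebraMap (Fp L) L))) (h : HA L e dV hdV dW hdW),
      ∀ i ∈ I S h, ∀ v ∈ T S h, ((v.residueCard : ℕ) : ℝ) ^ k₀ S i v h ≤
        ((((v.residueCard : ℕ) : ℝ) ^ mτ S v) * ∏ w' : UnitaryGroup.PlacesOver L v, (GLn.localHeight (2 + 2) L w'.1 ((gc S * h : HA L e dV hdV dW hdW) : GL (Fin (2 + 2)) (AdeleRing (𝓞 L) L)) : ℝ)) ^ c)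
    -- (c) the integrand on the ball near `z`
    (hN₂ : ∀ z : ℂ, 0 < z.re → ∃ (c' : ℕ) (r : ℝ), 0 < r ∧
      ∀ (S : skewMatrices ((IsCMField.complexConj L : L ≃ₐ[Fp L] L) : L →+* L) ((gramR L e dV hdV dW hdW).map (algebraMap (Fp L) L))) (s : ℂ), dist s z < r →
      ∀ (h : HA L e dV hdV dW hdW), ∀ i ∈ I S h, ∀ v ∈ T S h, ∀ x ∈ primePowBall (v.adicCompletion (Fp L)) (-(k₀ S i v h : ℤ)),
        ‖N₂v S i v s h x‖ ≤ ((((v.residueCard : ℕ) : ℝ) ^ k₀ S i v h) *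
          ∏ w' : UnitaryGroup.PlacesOver L v, (GLn.localHeight (2 + 2) L w'.1 ((gc S * h : HA L e dV hdV dW hdW) : GL (Fin (2 + 2)) (AdeleRing (𝓞 L) L)) : ℝ)) ^ c')
    -- (d) the Haar normalisation on balls
    (hvol : ∀ (v : HeightOneSpectrum (𝓞 (Fp L))) (k : ℕ), (μF v).real (primePowBall (v.adicCompletion (Fp L)) (-(k : ℤ))) ≤ ((v.residueCard : ℕ) : ℝ) ^ k) :
    ∀ z : ℂ, 0 < z.re → ∃ (Mv : ℕ) (r : ℝ), 0 < r ∧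
      ∀ (S : skewMatrices ((IsCMField.complexConj L : L ≃ₐ[Fp L] L) : L →+* L) ((gramR L e dV hdV dW hdW).map (algebraMap (Fp L) L))) (s : ℂ), dist s z < r →
      ∀ h : HA L e dV hdV dW hdW, (S : Matrix (Fin 2) (Fin 2) L) ≠ 0 → (S : Matrix (Fin 2) (Fin 2) L).det = 0 → ∀ i ∈ I S h, ∀ v ∈ T S h,
        ‖Gn S i v s h‖ ≤ ((((v.residueCard : ℕ) : ℝ) ^ (mτ S v + 1)) *
          ∏ w' : UnitaryGroup.PlacesOver L v, (GLn.localHeight (2 + 2) L w'.1 ((gc S * h : HA L e dV hdV dW hdW) : GL (Fin (2 + 2)) (AdeleRing (𝓞 L) L)) : ℝ)) ^ Mv := by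
  intro z hz
  obtain ⟨a, r₁, hr₁, hA⟩ := hcW z hz
  obtain ⟨c, hKc⟩ := hk₀
  obtain ⟨c', r₂, hr₂, hNc⟩ := hN₂ z hz
  refine ⟨a + c * (c' + 1) + c', min (min r₁ r₂) z.re, lt_min (lt_min hr₁ hr₂) hz, fun S s hs h hS0 hSd i hi v hv => ?_⟩
  have hs₁ : dist s z < r₁ := lt_of_lt_of_le hs ((min_le_left _ _).trans (min_le_left _ _))
  have hs₂ : dist s z < r₂ := lt_of_lt_of_le hs ((min_le_left _ _).trans (min_le_right _ _))
  have hsre : 0 < s.re := by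
    have h1 : |s.re - z.re| ≤ dist s z := by rw [Complex.dist_eq, ← Complex.sub_re]; exact Complex.abs_re_le_norm _
    have h3 := abs_lt.1 (lt_of_le_of_lt h1 (lt_of_lt_of_le hs (min_le_right _ _)))
    linarith [h3.1]
  -- currency: `q := q_v ≥ 2`, `P := ∏_w H_w ≥ 1`, `K := q^{k₀} ≥ 1`
  have hq : (2 : ℝ) ≤ ((v.residueCard : ℕ) : ℝ) := by exact_mod_cast Nat.succ_le_of_lt (HeightOneSpectrum.one_lt_residueCard v)
  have hq1 : (1 : ℝ) ≤ ((v.residueCard : ℕ) : ℝ) := le_trans one_le_two hq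
  have hP : (1 : ℝ) ≤ ∏ w' : UnitaryGroup.PlacesOver L v, (GLn.localHeight (2 + 2) L w'.1 ((gc S * h : HA L e dV hdV dW hdW) : GL (Fin (2 + 2)) (AdeleRing (𝓞 L) L)) : ℝ) :=
    Finset.one_le_prod fun w' _ => by exact_mod_cast GLn.one_le_localHeight (n := 2 + 2) (K := L) w'.1 ((gc S * h : HA L e dV hdV dW hdW) : GL (Fin (2 + 2)) (AdeleRing (𝓞 L) L))
  have hK : (1 : ℝ) ≤ ((v.residueCard : ℕ) : ℝ) ^ k₀ S i v h := one_le_pow₀ hq1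
  -- the ball clause and the three value letters
  rw [hball S hS0 hSd h i hi v hv s hsre]
  refine (norm_mul_setIntegral_le (μF v) (measure_primePowBall_lt_top (μF v) _) (hA S s hs₁ h i hi v hv) (hψ S v) (hNc S s hs₂ h i hi v hv)
    (pow_nonneg (mul_nonneg (zero_le_one.trans hK) (zero_le_one.trans hP)) _) (hvol v (k₀ S i v h))).trans ?_
  exact monomial_absorb hq hP hK (hKc S h i hi v hv)

end Head

end Summit.HodgeConjecture.HodgeConjecture.Cruxes.HLiu418.K2LiuKindOneSingularLocalFaceGrowth

end
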